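import Summits.QuantumFields.YangMills.Theorems.BalabanUVNodesN15KingModelHeatKernelCycle
import HarnessLib

/-!
# BalabanUVNodes ∕ N15 — THE KING-MODEL RUNG (PART ∇-b): THE DIFFERENCED HEAT KERNEL OF THE CYCLE `ℤ∕K` —
# `∇Q^{(K)}_s(n) = Q_s(n+1) − Q_s(n) = K⁻¹Σ_{k∈ℤ∕K} e^{−s(2−2cos θ_k)}·(ψ(k)−1)·ψ(kn)` and its MIXING BOUND `‖∇Q_s(n)‖ ≤ (π∕(2s))·e^{−8s∕K²}` (the zero mode drops out: `ψ(0) − 1 = 0`)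
# (the one-dimensional factor of PART ∇: the η-uniform inverse-cube law for the lattice gradient of King's `A = 0` covariance)
# (Track A, DAG node N15 = NE2; FAN-OUT v1.1 §N15 s3 «KING-MODEL RUNG … + what the curved case adds»; count-neutral)

HONEST FRAMING.  Count-neutral (cell `pub-ymgap`, seat `pub-ymgap-dag-n15-e` g57; `--supports stmt-QuantumFields-27247 --as helper` = K3ᴬ).  King's `A = 0` covariance on the torus is the
time integral of a product of cycle heat kernels `Q^{(K_μ)}_s(z_μ)` (PART Ϣ-f `kingPlaneWave_eq_integral`); its lattice gradient in direction `ν`, `G(x+e_ν,y) − G(x,y)`, differences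
exactly ONE factor: `Π_μQ(z_μ + δ_{μν}) − Π_μQ(z_μ) = ∇Q(z_ν)·Π_{μ≠ν}Q(z_μ)` (PART ∇-e).  This file is the one-dimensional object ★ `cycleHeatGrad K s n := cycleHeat K s (n+1) − cycleHeat K s n`
and the first of its two bounds — the MIXING (diagonal-type) bound, uniform in `n`; the DECAY bound in `|v(n)|` is PART ∇-c.  Everything is finite sums on `ℤ∕K` plus PART Ϣ-c; no integrals.
THE POINT.  `Q_s(0) ≤ 1∕K + e^{−8s∕K²}√(π∕(8s))` (PART Ϣ-c∕d): the zero mode `1∕K` never decays and is what forces the MASS into PART Ϣ's power law (`8c∕(m²K₀⁴)`).  The differenced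
kernel has NO zero mode — `ψ(0)−1 = 0` — and every other mode `k` pays `‖ψ(k)−1‖ = 2|sin(πv(k)∕K)| ≤ 2π|v(k)|∕K`, so the Gaussian shell sum becomes `Σ_w w·e^{−aw²} = O(1∕a)` instead of
`Σ_w e^{−aw²} = O(a^{−1∕2})`: `‖∇Q_s‖ ≤ (π∕(2s))e^{−8s∕K²}` — one half-power of `s` better than `Q_s(0)`, mass-free, and exponentially small beyond the mixing time.
CONTENTS.  §1 def `cycleHeatGrad`; ★ `cycleHeatGrad_eq_sum` (the Fourier form, `ψ(k(n+1)) = ψ(kn)ψ(k)`); `norm_cycleHeatGrad_le_two`; ★ `norm_cycleHeatGrad_le_symbol_sum`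
(`‖∇Q_s(n)‖ ≤ K⁻¹Σ_k e^{−s(2−2cosθ_k)}‖ψ(k)−1‖`); `continuous_cycleHeatGrad`; §2 the character: ★ `stdAddChar_eq_exp_cycAngle` (`ψ(k) = e^{iθ_k}`), ★ `norm_stdAddChar_sub_one_eq`
(`‖ψ(k)−1‖ = 2|sin(πv(k)∕K)|`), ★★ **`norm_stdAddChar_sub_one_le`** (`≤ 2π|v(k)|∕K`), ★ `norm_stdAddChar_one_sub_one_le` (`‖ψ(1)−1‖ ≤ 2π∕K`); §3 ★★ **`sum_range_succ_mul_exp_neg_mul_sq_le`**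
(THE WEIGHTED GAUSSIAN SHELL `Σ_{i<M}(i+1)e^{−a(i+1)²} ≤ 1∕a`: `xe^{−ax²∕2} ≤ √(3∕(8a))` termwise, then PART Ϣ-c's shell at `a∕2`, and `3π ≤ 16`); §4 ★★★ **`norm_cycleHeatGrad_le_mixing`**
(`‖∇Q_s(n)‖ ≤ (π∕(2s))·e^{−8s∕K²}`, `s > 0`, every `K ≥ 1`, every `n`), `norm_cycleHeatGrad_le_mixing'` (`≤ π∕(2s)`), `norm_cycleHeatGrad_le_min`.
PRIOR TREE ART (by name): PART Ϣ-c (`sum_univ_absV_le`, `exp_neg_mul_symbol_le`, `sum_range_exp_neg_mul_sq_succ_le`), PART Ϣ-d (`cycleHeat`, `cycAngle`, `norm_stdAddChar_eq_one`, `norm_cycleHeat_le_one`,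
`stdAddChar_neg_valMinAbs`); Mathlib `ZMod.stdAddChar_coe`, `ZMod.coe_valMinAbs`, `AddChar.map_add_eq_mul`, `Complex.norm_exp_I_mul_ofReal_sub_one`, `Real.abs_sin_le_abs`,
`Real.mul_exp_neg_le_exp_neg_one`, `Real.abs_le_sqrt`.
Dedup (rg at filing): basename 0 files; needles `cycleHeatGrad|norm_cycleHeatGrad|stdAddChar_eq_exp_cycAngle|norm_stdAddChar_sub_one_le|sum_range_succ_mul_exp_neg_mul_sq_le` 0 tree files.
Locators: [King1986] (4.4) p.670 (symbol and reduced momenta), (4.35) p.674 (plane-wave sums), (3.63) p.663 (the gradient entries); [Balaban1984PropagatorsI] (1.29) p.23; [LawlerLimic2010]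
§2.3 (method).  0 `sorry`; 1 `def` (`cycleHeatGrad`).
-/

noncomputable section

open Real Set Finset Complex
open scoped BigOperators

namespace Summit.QuantumFields.YangMills.BalabanUVNodes.N15KingModelRung.HeatKernel

variable (K : ℕ) [NeZero K]

/-! ## §1 The differenced cycle heat kernel and its Fourier form -/

/-- ★ THE DIFFERENCED HEAT KERNEL OF THE CYCLE: `∇Q^{(K)}_s(n) = Q_s(n+1) − Q_s(n)` (forward lattice gradient in the site variable). [cite: King1986, (4.4) p.670, (3.63) p.663] -/
def cycleHeatGrad (s : ℝ) (n : ZMod K) : ℂ := cycleHeat K s (n + 1) - cycleHeat K s n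

variable {K}

/-- ★ THE FOURIER FORM: `∇Q_s(n) = K⁻¹Σ_k e^{−s(2−2cos θ_k)}·((ψ(k) − 1)·ψ(kn))` (`ψ(k(n+1)) = ψ(kn)ψ(k)`). [cite: King1986, (4.4) p.670, (4.35) p.674] -/
theorem cycleHeatGrad_eq_sum (s : ℝ) (n : ZMod K) :
    cycleHeatGrad K s n = (K : ℂ)⁻¹ * ∑ k : ZMod K, ((Real.exp (-(s * (2 - 2 * Real.cos (cycAngle K k)))) : ℝ) : ℂ) * ((ZMod.stdAddChar k - 1) * ZMod.stdAddChar (k * n)) := by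
  unfold cycleHeatGrad cycleHeat
  rw [← mul_sub, ← Finset.sum_sub_distrib]
  congr 1
  refine Finset.sum_congr rfl fun k _ => ?_
  rw [show k * (n + 1) = k * n + k by ring, AddChar.map_add_eq_mul]
  ring

/-- `‖∇Q_s(n)‖ ≤ 2` for `s ≥ 0`. [folklore] -/
theorem norm_cycleHeatGrad_le_two {s : ℝ} (hs : 0 ≤ s) (n : ZMod K) : ‖cycleHeatGrad K s n‖ ≤ 2 := by
  unfold cycleHeatGrad
  calc ‖cycleHeat K s (n + 1) - cycleHeat K s n‖ ≤ ‖cycleHeat K s (n + 1)‖ + ‖cycleHeat K s n‖ := norm_sub_le _ _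
    _ ≤ 1 + 1 := add_le_add (norm_cycleHeat_le_one hs _) (norm_cycleHeat_le_one hs _)
    _ = 2 := by norm_num

/-- ★ `‖∇Q_s(n)‖ ≤ K⁻¹Σ_k e^{−s(2−2cos θ_k)}·‖ψ(k) − 1‖` (the character `ψ(kn)` has norm one). [cite: King1986, (4.35) p.674] -/
theorem norm_cycleHeatGrad_le_symbol_sum (s : ℝ) (n : ZMod K) :
    ‖cycleHeatGrad K s n‖ ≤ (K : ℝ)⁻¹ * ∑ k : ZMod K, Real.exp (-(s * (2 - 2 * Real.cos (cycAngle K k)))) * ‖(ZMod.stdAddChar k : ℂ) - 1‖ := by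
  rw [cycleHeatGrad_eq_sum, norm_mul, norm_inv]
  have hK : ‖(K : ℂ)‖ = (K : ℝ) := by simp
  rw [hK]
  refine mul_le_mul_of_nonneg_left ((norm_sum_le _ _).trans (le_of_eq ?_)) (by positivity)
  refine Finset.sum_congr rfl fun k _ => ?_
  rw [norm_mul, norm_mul, norm_stdAddChar_eq_one, mul_one, Complex.norm_real, Real.norm_eq_abs, abs_of_pos (Real.exp_pos _)]

/-- `s ↦ ∇Q_s(n)` is continuous. [folklore] -/
theorem continuous_cycleHeatGrad (n : ZMod K) : Continuous fun s : ℝ => cycleHeatGrad K s n :=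
  (continuous_cycleHeat (n + 1)).sub (continuous_cycleHeat n)

/-! ## §2 The character `ψ(k) = e^{iθ_k}` and `‖ψ(k) − 1‖ ≤ 2π|v(k)|∕K` -/

/-- ★ `ψ_K(k) = e^{iθ_k}` with `θ_k = 2πv(k)∕K` (`k ≡ v(k)`). [folklore] -/
theorem stdAddChar_eq_exp_cycAngle (k : ZMod K) : (ZMod.stdAddChar k : ℂ) = Complex.exp (Complex.I * ((cycAngle K k : ℝ) : ℂ)) := by
  have h : k = (((k.valMinAbs : ℤ)) : ZMod K) := (ZMod.coe_valMinAbs k).symm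
  conv_lhs => rw [h]
  rw [ZMod.stdAddChar_coe]
  congr 1
  unfold cycAngle
  push_cast
  ring

/-- ★ `‖ψ_K(k) − 1‖ = 2|sin(πv(k)∕K)|`. [folklore] -/
theorem norm_stdAddChar_sub_one_eq (k : ZMod K) : ‖(ZMod.stdAddChar k : ℂ) - 1‖ = 2 * |Real.sin (π * (k.valMinAbs : ℝ) / K)| := by
  rw [stdAddChar_eq_exp_cycAngle, Complex.norm_exp_I_mul_ofReal_sub_one, Real.norm_eq_abs, abs_mul, abs_two]
  unfold cycAngle
  congr 2
  congr 1
  ring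

/-- ★★ **`‖ψ_K(k) − 1‖ ≤ 2π|v(k)|∕K`** (`|sin y| ≤ |y|`): the mode `k` of the differenced kernel pays its reduced momentum. [cite: King1986, (4.4) p.670] -/
theorem norm_stdAddChar_sub_one_le (k : ZMod K) : ‖(ZMod.stdAddChar k : ℂ) - 1‖ ≤ 2 * π * ((k.valMinAbs.natAbs : ℕ) : ℝ) / K := by
  have hK : (0 : ℝ) < K := by exact_mod_cast Nat.pos_of_ne_zero (NeZero.ne K)
  rw [norm_stdAddChar_sub_one_eq]
  have h1 : |Real.sin (π * (k.valMinAbs : ℝ) / K)| ≤ |π * (k.valMinAbs : ℝ) / K| := Real.abs_sin_le_abs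
  have hv : ((k.valMinAbs.natAbs : ℕ) : ℝ) = |(k.valMinAbs : ℝ)| := by rw [Nat.cast_natAbs, Int.cast_abs]
  rw [hv]
  have e : |π * (k.valMinAbs : ℝ) / K| = π * |(k.valMinAbs : ℝ)| / K := by
    rw [abs_div, abs_mul, abs_of_pos Real.pi_pos, abs_of_pos hK]
  rw [e] at h1
  have e2 : 2 * π * |(k.valMinAbs : ℝ)| / K = 2 * (π * |(k.valMinAbs : ℝ)| / K) := by ring
  rw [e2]
  linarith

/-- ★ `‖ψ_K(1) − 1‖ ≤ 2π∕K` (`ψ(1) = e^{2πi∕K}`, `|sin(π∕K)| ≤ π∕K`). [folklore] -/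
theorem norm_stdAddChar_one_sub_one_le : ‖(ZMod.stdAddChar (1 : ZMod K) : ℂ) - 1‖ ≤ 2 * π / K := by
  have hK : (0 : ℝ) < K := by exact_mod_cast Nat.pos_of_ne_zero (NeZero.ne K)
  have h : (ZMod.stdAddChar (1 : ZMod K) : ℂ) = Complex.exp (Complex.I * (((2 * π / K : ℝ)) : ℂ)) := by
    rw [show (1 : ZMod K) = (((1 : ℤ)) : ZMod K) by simp, ZMod.stdAddChar_coe]
    congr 1
    push_cast
    ring
  rw [h, Complex.norm_exp_I_mul_ofReal_sub_one, Real.norm_eq_abs, abs_mul, abs_two]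
  have h1 : |Real.sin (2 * π / K / 2)| ≤ |2 * π / (K : ℝ) / 2| := Real.abs_sin_le_abs
  have e : |2 * π / (K : ℝ) / 2| = π / K := by rw [abs_of_pos (by positivity)]; ring
  rw [e] at h1
  calc 2 * |Real.sin (2 * π / K / 2)| ≤ 2 * (π / K) := by linarith
    _ = 2 * π / K := by ring

/-! ## §3 The weighted Gaussian shell `Σ_{w≥1} w·e^{−aw²} ≤ 1∕a` -/

/-- `x·e^{−(a∕2)x²} ≤ √(3∕(8a))` for `a > 0`, `x ≥ 0` (square: `x²e^{−ax²} = a⁻¹·(ax²)e^{−ax²} ≤ e⁻¹∕a < 3∕(8a)`). [folklore] -/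
theorem mul_exp_neg_half_mul_sq_le {a : ℝ} (ha : 0 < a) {x : ℝ} (hx : 0 ≤ x) : x * Real.exp (-(a / 2 * x ^ 2)) ≤ Real.sqrt (3 / (8 * a)) := by
  have he : Real.exp (-1) < 3 / 8 := lt_trans Real.exp_neg_one_lt_d9 (by norm_num)
  have hsq : (x * Real.exp (-(a / 2 * x ^ 2))) ^ 2 ≤ 3 / (8 * a) := by
    have e : (x * Real.exp (-(a / 2 * x ^ 2))) ^ 2 = a⁻¹ * ((a * x ^ 2) * Real.exp (-(a * x ^ 2))) := by
      rw [mul_pow, sq (Real.exp _), ← Real.exp_add]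
      field_simp
      ring_nf
    rw [e]
    have h1 := Real.mul_exp_neg_le_exp_neg_one (a * x ^ 2)
    calc a⁻¹ * ((a * x ^ 2) * Real.exp (-(a * x ^ 2))) ≤ a⁻¹ * (3 / 8) := mul_le_mul_of_nonneg_left (h1.trans he.le) (by positivity)
      _ = 3 / (8 * a) := by field_simp
  have h := Real.abs_le_sqrt hsq
  rwa [abs_of_nonneg (by positivity)] at h

/-- ★★ **THE WEIGHTED GAUSSIAN SHELL**: `Σ_{i<M}(i+1)·e^{−a(i+1)²} ≤ 1∕a` for `a > 0` — termwise `(i+1)e^{−(a∕2)(i+1)²} ≤ √(3∕(8a))`, then PART Ϣ-c's shell `Σe^{−(a∕2)(i+1)²} ≤ ½√(2π∕a)`, and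
`√(3∕(8a))·½√(2π∕a) = ½√(3π∕4)∕a ≤ 1∕a` (`3π ≤ 16`).  This is the `O(1∕a)` that replaces `O(a^{−1∕2})` once every mode carries its momentum. [folklore] -/
theorem sum_range_succ_mul_exp_neg_mul_sq_le {a : ℝ} (ha : 0 < a) (M : ℕ) :
    ∑ i ∈ Finset.range M, ((i + 1 : ℕ) : ℝ) * Real.exp (-a * ((i + 1 : ℕ) : ℝ) ^ 2) ≤ 1 / a := by
  have hterm : ∀ i ∈ Finset.range M, ((i + 1 : ℕ) : ℝ) * Real.exp (-a * ((i + 1 : ℕ) : ℝ) ^ 2)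
      ≤ Real.sqrt (3 / (8 * a)) * Real.exp (-(a / 2) * ((i + 1 : ℕ) : ℝ) ^ 2) := by
    intro i _
    have h := mul_exp_neg_half_mul_sq_le ha (x := ((i + 1 : ℕ) : ℝ)) (by positivity)
    have e : Real.exp (-a * ((i + 1 : ℕ) : ℝ) ^ 2) = Real.exp (-(a / 2 * ((i + 1 : ℕ) : ℝ) ^ 2)) * Real.exp (-(a / 2) * ((i + 1 : ℕ) : ℝ) ^ 2) := by
      rw [← Real.exp_add]; ring_nf
    rw [e, ← mul_assoc]
    exact mul_le_mul_of_nonneg_right h (Real.exp_pos _).le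
  have hsum := Finset.sum_le_sum hterm
  rw [← Finset.mul_sum] at hsum
  have ha2 : 0 < a / 2 := by positivity
  have hshell := sum_range_exp_neg_mul_sq_succ_le ha2 M
  have h0 : 0 ≤ Real.sqrt (3 / (8 * a)) := Real.sqrt_nonneg _
  have hkey : Real.sqrt (3 / (8 * a)) * (Real.sqrt (π / (a / 2)) / 2) ≤ 1 / a := by
    rw [← mul_div_assoc, ← Real.sqrt_mul (by positivity)]
    have e : 3 / (8 * a) * (π / (a / 2)) = (3 * π / 4) * (1 / a) ^ 2 := by field_simp; ring
    rw [e, Real.sqrt_mul (by positivity), Real.sqrt_sq (by positivity)]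
    have hπ : 3 * π / 4 ≤ 4 := by nlinarith [Real.pi_lt_d2]
    have hs4 : Real.sqrt (3 * π / 4) ≤ 2 := by
      rw [show (2 : ℝ) = Real.sqrt 4 by rw [show (4 : ℝ) = 2 ^ 2 by norm_num, Real.sqrt_sq (by norm_num)]]
      exact Real.sqrt_le_sqrt hπ
    have h1a : 0 ≤ 1 / a := by positivity
    calc Real.sqrt (3 * π / 4) * (1 / a) / 2 ≤ 2 * (1 / a) / 2 := by gcongr
      _ = 1 / a := by ring
  calc ∑ i ∈ Finset.range M, ((i + 1 : ℕ) : ℝ) * Real.exp (-a * ((i + 1 : ℕ) : ℝ) ^ 2)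
      ≤ Real.sqrt (3 / (8 * a)) * ∑ i ∈ Finset.range M, Real.exp (-(a / 2) * ((i + 1 : ℕ) : ℝ) ^ 2) := hsum
    _ ≤ Real.sqrt (3 / (8 * a)) * (Real.sqrt (π / (a / 2)) / 2) := mul_le_mul_of_nonneg_left hshell h0
    _ ≤ 1 / a := hkey

/-! ## §4 The mixing bound for the differenced kernel -/

/-- ★★★ **THE MIXING BOUND FOR THE DIFFERENCED CYCLE HEAT KERNEL**: `‖∇Q^{(K)}_s(n)‖ ≤ (π∕(2s))·e^{−8s∕K²}` for `s > 0`, every `K ≥ 1`, every `n` — the zero mode is absent (`ψ(0) = 1`),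
the mode `k` pays `2π|v(k)|∕K` (§2) against `e^{−16s|v(k)|²∕K²}` (Jordan, PART Ϣ-c), one factor `e^{−8s∕K²}` is peeled off (`16sw² ≥ 8s + 8sw²` for `w ≥ 1`) and the weighted shell
`(4π∕K²)Σ_w we^{−(8s∕K²)w²} ≤ (4π∕K²)(K²∕(8s))` (§3) is `π∕(2s)`: ONE HALF-POWER of `s` better than `Q_s(0) = O(s^{−1∕2})`, NO `1∕K`, NO mass. [cite: King1986, (4.4) p.670, (4.35) p.674, (3.63) p.663] -/
theorem norm_cycleHeatGrad_le_mixing {s : ℝ} (hs : 0 < s) (n : ZMod K) :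
    ‖cycleHeatGrad K s n‖ ≤ π / (2 * s) * Real.exp (-(8 * s / (K : ℝ) ^ 2)) := by
  have hK : (0 : ℝ) < K := by exact_mod_cast Nat.pos_of_ne_zero (NeZero.ne K)
  have h1 := norm_cycleHeatGrad_le_symbol_sum (K := K) s n
  -- every mode through `|v(k)|`
  set φ : ℕ → ℝ := fun w => Real.exp (-(16 * s / (K : ℝ) ^ 2) * (w : ℝ) ^ 2) * (2 * π * (w : ℝ) / K) with hφ
  have hφ0 : ∀ w, 0 ≤ φ w := fun w => by simp only [hφ]; positivity
  have h2 : ∑ k : ZMod K, Real.exp (-(s * (2 - 2 * Real.cos (cycAngle K k)))) * ‖(ZMod.stdAddChar k : ℂ) - 1‖ ≤ ∑ k : ZMod K, φ (k.valMinAbs.natAbs) := by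
    refine Finset.sum_le_sum fun k _ => ?_
    simp only [hφ]
    exact mul_le_mul (exp_neg_mul_symbol_le hs.le k) (norm_stdAddChar_sub_one_le k) (norm_nonneg _) (Real.exp_pos _).le
  have h3 := sum_univ_absV_le (K := K) φ hφ0
  have hφz : φ 0 = 0 := by simp [hφ]
  rw [hφz, zero_add] at h3
  -- peel `e^{−8s/K²}` and sum the weighted shell
  have ha : 0 < 8 * s / (K : ℝ) ^ 2 := by positivity
  have h4 : ∑ i ∈ Finset.range (K / 2), φ (i + 1)
      ≤ 2 * π / K * Real.exp (-(8 * s / (K : ℝ) ^ 2)) * ∑ i ∈ Finset.range (K / 2), ((i + 1 : ℕ) : ℝ) * Real.exp (-(8 * s / (K : ℝ) ^ 2) * ((i + 1 : ℕ) : ℝ) ^ 2) := by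
    rw [Finset.mul_sum]
    refine Finset.sum_le_sum fun i _ => ?_
    simp only [hφ]
    have hpeel : Real.exp (-(16 * s / (K : ℝ) ^ 2) * ((i + 1 : ℕ) : ℝ) ^ 2)
        ≤ Real.exp (-(8 * s / (K : ℝ) ^ 2)) * Real.exp (-(8 * s / (K : ℝ) ^ 2) * ((i + 1 : ℕ) : ℝ) ^ 2) := by
      rw [← Real.exp_add]
      apply Real.exp_le_exp.mpr
      have h1' : (1 : ℝ) ≤ ((i + 1 : ℕ) : ℝ) ^ 2 := by
        have : (1 : ℝ) ≤ ((i + 1 : ℕ) : ℝ) := by exact_mod_cast Nat.succ_le_succ (Nat.zero_le i)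
        nlinarith
      have h2' : 0 ≤ 8 * s / (K : ℝ) ^ 2 * (((i + 1 : ℕ) : ℝ) ^ 2 - 1) := mul_nonneg ha.le (by linarith)
      have e : (16 * s / (K : ℝ) ^ 2) * ((i + 1 : ℕ) : ℝ) ^ 2 = 2 * ((8 * s / (K : ℝ) ^ 2) * ((i + 1 : ℕ) : ℝ) ^ 2) := by ring
      rw [neg_mul, neg_mul, e]
      nlinarith [h2']
    have hw0 : 0 ≤ 2 * π * ((i + 1 : ℕ) : ℝ) / K := by positivity
    have := mul_le_mul_of_nonneg_right hpeel hw0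
    push_cast at this ⊢
    calc Real.exp (-(16 * s / (K : ℝ) ^ 2) * ((i : ℝ) + 1) ^ 2) * (2 * π * ((i : ℝ) + 1) / K)
        ≤ Real.exp (-(8 * s / (K : ℝ) ^ 2)) * Real.exp (-(8 * s / (K : ℝ) ^ 2) * ((i : ℝ) + 1) ^ 2) * (2 * π * ((i : ℝ) + 1) / K) := this
      _ = 2 * π / K * Real.exp (-(8 * s / (K : ℝ) ^ 2)) * (((i : ℝ) + 1) * Real.exp (-(8 * s / (K : ℝ) ^ 2) * ((i : ℝ) + 1) ^ 2)) := by ring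
  have h5 := sum_range_succ_mul_exp_neg_mul_sq_le ha (K / 2)
  have hC0 : 0 ≤ 2 * π / K * Real.exp (-(8 * s / (K : ℝ) ^ 2)) := by positivity
  have h6 : ∑ i ∈ Finset.range (K / 2), φ (i + 1) ≤ 2 * π / K * Real.exp (-(8 * s / (K : ℝ) ^ 2)) * (1 / (8 * s / (K : ℝ) ^ 2)) :=
    h4.trans (mul_le_mul_of_nonneg_left h5 hC0)
  have e : (K : ℝ)⁻¹ * (2 * (2 * π / K * Real.exp (-(8 * s / (K : ℝ) ^ 2)) * (1 / (8 * s / (K : ℝ) ^ 2)))) = π / (2 * s) * Real.exp (-(8 * s / (K : ℝ) ^ 2)) := by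
    field_simp
    ring
  calc ‖cycleHeatGrad K s n‖ ≤ (K : ℝ)⁻¹ * ∑ k : ZMod K, Real.exp (-(s * (2 - 2 * Real.cos (cycAngle K k)))) * ‖(ZMod.stdAddChar k : ℂ) - 1‖ := h1
    _ ≤ (K : ℝ)⁻¹ * ∑ k : ZMod K, φ (k.valMinAbs.natAbs) := mul_le_mul_of_nonneg_left h2 (by positivity)
    _ ≤ (K : ℝ)⁻¹ * (2 * ∑ i ∈ Finset.range (K / 2), φ (i + 1)) := mul_le_mul_of_nonneg_left h3 (by positivity)
    _ ≤ (K : ℝ)⁻¹ * (2 * (2 * π / K * Real.exp (-(8 * s / (K : ℝ) ^ 2)) * (1 / (8 * s / (K : ℝ) ^ 2)))) := by gcongr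
    _ = π / (2 * s) * Real.exp (-(8 * s / (K : ℝ) ^ 2)) := e

/-- The coarse form without the mixing factor: `‖∇Q_s(n)‖ ≤ π∕(2s)` (`s > 0`). [cite: King1986, (4.4) p.670] -/
theorem norm_cycleHeatGrad_le_mixing' {s : ℝ} (hs : 0 < s) (n : ZMod K) : ‖cycleHeatGrad K s n‖ ≤ π / (2 * s) := by
  refine (norm_cycleHeatGrad_le_mixing hs n).trans ?_
  have h1 : Real.exp (-(8 * s / (K : ℝ) ^ 2)) ≤ 1 := by rw [Real.exp_le_one_iff]; exact neg_nonpos.mpr (by positivity)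
  have h0 : 0 ≤ π / (2 * s) := by positivity
  calc π / (2 * s) * Real.exp (-(8 * s / (K : ℝ) ^ 2)) ≤ π / (2 * s) * 1 := mul_le_mul_of_nonneg_left h1 h0
    _ = π / (2 * s) := mul_one _

/-- Both bounds at once: `‖∇Q_s(n)‖ ≤ min(2, π∕(2s))` (`s > 0`). [folklore] -/
theorem norm_cycleHeatGrad_le_min {s : ℝ} (hs : 0 < s) (n : ZMod K) : ‖cycleHeatGrad K s n‖ ≤ min 2 (π / (2 * s)) :=
  le_min (norm_cycleHeatGrad_le_two hs.le n) (norm_cycleHeatGrad_le_mixing' hs n)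

end Summit.QuantumFields.YangMills.BalabanUVNodes.N15KingModelRung.HeatKernel

end
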